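import Literature.NumberTheory.LFunctions.Zhang2022.DetectorShiftPSDSharpTwist
import Literature.NumberTheory.LFunctions.Zhang2022.DetectorSlotHierarchy
import Literature.NumberTheory.LFunctions.Zhang2022.DetectorDoublingIdentity
import Literature.NumberTheory.LFunctions.Zhang2022.DetectorDoublingCompose
import Literature.NumberTheory.LFunctions.Zhang2022.DetectorShiftDoubledParseval

/-!
# PINNED LATTICE MODES: the finitary FAIL half of the slot-region criterion for the one-sided shift-detector form

Y. Zhang, *Discrete mean estimates and the Landau–Siegel zero*, arXiv:2211.02515v1 [Zhang2022LandauSiegel] — an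
unrefereed manuscript under adjudication. Sub-cell E of the `landau-siegel` programme (ls-barrier-p6 g5; desk criterion
HOME/barrier/p5/GLUED-SLOT-REGION.md §2(d), ls-barrier-p5 g5). **WHAT THIS IS NOT: not a claim about Theorems 1–2 of
arXiv:2211.02515, about Landau–Siegel zeros, about a repaired `Margin232`, or about Parity.**

For a pairwise-distinct real shift triple `b` with `c₀(b) = Re Σ_j W_j(b) > 0`, the one-sided main-term form
`𝔅_{R(b)}` of the shift recipe (`Det.FormDet (Det.shiftRecipe b)`, E*-S (ii) slot `Det.FormDetPSD`) is, on the circle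
`ℝ/2ℤ`, the lattice-diagonal form `2π⁴·Σ_m σ_b(m)|ĉ_m|²` (`σ_b = Det.latticeSymbol`) restricted by ONE linear pin
`Σ_m m·ĉ_m = 0` (the mode `m = 0` has zero energy and absorbs the other boundary condition). This file proves the
FINITARY NEGATIVE HALF of that picture, for ALL such `b` at once:

* `Det.formDet_pinProfile_le`: for every finite `s ⊂ ℤ` and coefficients `c` with `Σ_{m∈s} m·c_m = 0`, the explicit
  one-sided profile `g = −P′`, `P(y) = Σ_{m∈s} c_m e^{iπm(y−1)}`, has `(π/2)·𝔅_{R(b)}(g) ≤ c₀(b)·2π⁴·Σ_{m∈s} σ_b(m)‖c_m‖²`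
  whenever the doubly-clamped bulk form is PSD (case (A)); [K1] `Det.formDet_shiftRecipe_eq_bulk_add_freeEnd` + the
  doubling identity D1 `Det.doublingIdentity_clamped_of_re_ne_zero` + bridge minimality
  `Det.bulkFormOn_extremal_le_of_clampedNonneg` against the competitor `P(·−1) − P(1)` + Parseval on the period cell
  `Det.hasSum_bulkFormOn_circle`.
* `Det.not_formDetPSD_of_pinnedModes`: pin + NEGATIVE lattice energy ⇒ `¬ FormDetPSD (shiftRecipe b)` (case (B) by
  `Det.not_formDetPSD_of_clampedNegWitness`), hence `¬ GluedFormPSD b` and `¬ DictShiftPSD b` (`DetectorSlotHierarchy`).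
* Corollaries = the two FAIL clauses of the desk criterion: `Det.not_formDetPSD_of_two_modes` (two lattice points with
  `σ_b(m₁) < 0`, `σ_b(m₂) ≤ 0`, `m₂ ≠ 0` — «N(b) ≥ 2», or a negative mode plus a zero mode) and
  `Det.not_formDetPSD_of_pin_excess` (one negative mode `m₀` and a finite set of positive modes with
  `|σ_b(m₀)|·Σ m²/σ_b(m) > m₀²` — the finitary form of «N = 1 ∧ S(b) > 0»; every instance is `norm_num` on rationals).

0 named facts, 0 sorries; standard axioms. Nothing here asserts anything about `L`-functions.
«The programme SEARCHES and TYPES; no claim about Landau–Siegel zeros, Theorems 1–2 of arXiv:2211.02515 or a repaired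
Margin232 until a kernel theorem says so.»
[cite: Zhang2022LandauSiegel, §2 Lemma 2.3; Prop 7.1 p.44 with (7.2), (8.11)–(8.23); §18 (18.1)]
-/

noncomputable section

open Complex Real ComplexConjugate Set MeasureTheory intervalIntegral

namespace Literature.NumberTheory.LFunctions.Zhang2022

namespace Det

open Repair

/-! ### Part 1 — lattice modes: values on the period cell and orthogonality -/

section Modes

variable (m : ℤ)

/-- `F_m` is continuous. [cite: Zhang2022LandauSiegel, Prop 7.1 p.44 with (8.11)–(8.23)] -/
theorem continuous_latticeMode : Continuous (latticeMode m) :=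
  continuous_iff_continuousAt.2 fun y => (hasDerivAt_latticeMode m y).continuousAt

/-- `F_m′` is continuous. [cite: Zhang2022LandauSiegel, Prop 7.1 p.44 with (8.11)–(8.23)] -/
theorem continuous_latticeModeD : Continuous (latticeModeD m) :=
  continuous_iff_continuousAt.2 fun y => (hasDerivAt_latticeModeD m y).continuousAt

/-- `F_m″` is continuous. [cite: Zhang2022LandauSiegel, Prop 7.1 p.44 with (8.11)–(8.23)] -/
theorem continuous_latticeModeDD : Continuous (latticeModeDD m) := by
  unfold latticeModeDD
  exact continuous_const.mul (continuous_latticeMode m)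

/-- `|F_m(y)| = 1`. [cite: Zhang2022LandauSiegel, Prop 7.1 p.44 with (8.11)–(8.23)] -/
theorem norm_latticeMode (y : ℝ) : ‖latticeMode m y‖ = 1 := by
  unfold latticeMode
  exact Complex.norm_exp_ofReal_mul_I _

/-- `F_m(−2) = 1` (period `2`). [cite: Zhang2022LandauSiegel, Prop 7.1 p.44 with (8.11)–(8.23)] -/
theorem latticeMode_neg_two : latticeMode m (-2) = 1 := by
  unfold latticeMode
  rw [show (((π * m * (-2:ℝ) : ℝ)) : ℂ) * I = ((-m : ℤ) : ℂ) * (2 * π * I) by push_cast; ring]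
  exact Complex.exp_int_mul_two_pi_mul_I (-m)

/-- `F_m′(0) = iπm`. [cite: Zhang2022LandauSiegel, Prop 7.1 p.44 with (8.11)–(8.23)] -/
theorem latticeModeD_zero : latticeModeD m 0 = ((π * m : ℝ) : ℂ) * I := by
  simp [latticeModeD, latticeMode_zero]

/-- `F_m′(−2) = iπm`. [cite: Zhang2022LandauSiegel, Prop 7.1 p.44 with (8.11)–(8.23)] -/
theorem latticeModeD_neg_two : latticeModeD m (-2) = ((π * m : ℝ) : ℂ) * I := by
  simp [latticeModeD, latticeMode_neg_two]

/-- Product rule on the cell: `F_{m'}(y−1)·e^{−iπmy} = F_{m'}(−1)·F_{m'−m}(y)`.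
[cite: Zhang2022LandauSiegel, Prop 7.1 p.44 with (8.11)–(8.23)] -/
theorem latticeMode_sub_one_mul_ker (m' m : ℤ) (y : ℝ) :
    latticeMode m' (y - 1) * cexp (-(I * π * m * y)) = latticeMode m' (-1) * latticeMode (m' - m) y := by
  unfold latticeMode
  rw [← Complex.exp_add, ← Complex.exp_add]
  congr 1
  push_cast
  ring

/-- The kernel `e^{−iπmy}` is the mode `F_{−m}`. [cite: Zhang2022LandauSiegel, Prop 7.1 p.44 with (8.11)–(8.23)] -/
theorem ker_eq_latticeMode (y : ℝ) : cexp (-(I * π * m * y)) = latticeMode (-m) y := by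
  unfold latticeMode
  congr 1
  push_cast
  ring

/-- **Orthogonality on the period cell**: `∫_{−1}^{1} F_k = 2` if `k = 0`, and `= 0` otherwise (`F_k(1) = F_k(−1) = (−1)^k`).
[cite: Zhang2022LandauSiegel, Prop 7.1 p.44 with (8.11)–(8.23)] -/
theorem integral_latticeMode_cell (k : ℤ) :
    ∫ y in (-1:ℝ)..1, latticeMode k y = if k = 0 then 2 else 0 := by
  split_ifs with hk
  · subst hk
    have : latticeMode 0 = fun _ => (1:ℂ) := by
      funext y; simp [latticeMode]
    rw [this, intervalIntegral.integral_const]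
    norm_num
  · have hπk : ((π * k : ℝ) : ℂ) * I ≠ 0 := by
      apply mul_ne_zero _ Complex.I_ne_zero
      exact_mod_cast mul_ne_zero Real.pi_ne_zero (Int.cast_ne_zero.2 hk)
    have hF : ∀ y ∈ uIcc (-1:ℝ) 1,
        HasDerivAt (fun y => latticeMode k y / (((π * k : ℝ) : ℂ) * I)) (latticeMode k y) y := by
      intro y _
      have h := (hasDerivAt_latticeMode k y).div_const (((π * k : ℝ) : ℂ) * I)
      refine h.congr_deriv ?_
      unfold latticeModeD
      field_simp
    rw [intervalIntegral.integral_eq_sub_of_hasDerivAt hF ((continuous_latticeMode k).intervalIntegrable _ _)]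
    have h1 : latticeMode k 1 = (((-1 : ℝ) ^ k : ℝ) : ℂ) := latticeMode_one k
    have hm1 : latticeMode k (-1) = (((-1 : ℝ) ^ k : ℝ) : ℂ) := by
      have h := latticeMode_add_one k (-1)
      rw [show (-1:ℝ) + 1 = 0 by norm_num, latticeMode_zero] at h
      -- `1 = ω · F_k(−1)` with `ω² = 1`
      have hω2 : ((((-1 : ℝ) ^ k : ℝ) : ℂ)) * (((-1 : ℝ) ^ k : ℝ) : ℂ) = 1 := by
        rw [← Complex.ofReal_mul, ← sq, ← zpow_natCast, ← zpow_mul, mul_comm, zpow_mul]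
        norm_num
      calc latticeMode k (-1) = ((((-1 : ℝ) ^ k : ℝ) : ℂ) * (((-1 : ℝ) ^ k : ℝ) : ℂ)) * latticeMode k (-1) := by
              rw [hω2, one_mul]
        _ = (((-1 : ℝ) ^ k : ℝ) : ℂ) * ((((-1 : ℝ) ^ k : ℝ) : ℂ) * latticeMode k (-1)) := by ring
        _ = (((-1 : ℝ) ^ k : ℝ) : ℂ) := by rw [← h, mul_one]
    rw [h1, hm1, sub_self]

end Modes

/-! ### Part 2 — trigonometric polynomials on the lattice and the pinned one-sided profile -/

section TrigPoly

/-- The trigonometric polynomial `P_{s,c}(y − a) = Σ_{m∈s} c_m·e^{iπm(y−a)}` (period `2`).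
[cite: Zhang2022LandauSiegel, Prop 7.1 p.44 with (8.11)–(8.23)] -/
def modePoly (s : Finset ℤ) (c : ℤ → ℂ) (a : ℝ) (y : ℝ) : ℂ := ∑ m ∈ s, c m * latticeMode m (y - a)

/-- Its derivative `Σ_{m∈s} c_m·F_m′(y−a)`. [cite: Zhang2022LandauSiegel, Prop 7.1 p.44 with (8.11)–(8.23)] -/
def modePolyD (s : Finset ℤ) (c : ℤ → ℂ) (a : ℝ) (y : ℝ) : ℂ := ∑ m ∈ s, c m * latticeModeD m (y - a)

/-- Its second derivative `Σ_{m∈s} c_m·F_m″(y−a)`. [cite: Zhang2022LandauSiegel, Prop 7.1 p.44 with (8.11)–(8.23)] -/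
def modePolyDD (s : Finset ℤ) (c : ℤ → ℂ) (a : ℝ) (y : ℝ) : ℂ := ∑ m ∈ s, c m * latticeModeDD m (y - a)

variable (s : Finset ℤ) (c : ℤ → ℂ)

/-- `P′` is the derivative of `P`. [cite: Zhang2022LandauSiegel, Prop 7.1 p.44 with (8.11)–(8.23)] -/
theorem hasDerivAt_modePoly (a y : ℝ) : HasDerivAt (modePoly s c a) (modePolyD s c a y) y := by
  unfold modePoly modePolyD
  exact HasDerivAt.fun_sum fun m _ => ((hasDerivAt_latticeMode m (y - a)).comp_sub_const y a).const_mul (c m)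

/-- `P″` is the derivative of `P′`. [cite: Zhang2022LandauSiegel, Prop 7.1 p.44 with (8.11)–(8.23)] -/
theorem hasDerivAt_modePolyD (a y : ℝ) : HasDerivAt (modePolyD s c a) (modePolyDD s c a y) y := by
  unfold modePolyD modePolyDD
  exact HasDerivAt.fun_sum fun m _ => ((hasDerivAt_latticeModeD m (y - a)).comp_sub_const y a).const_mul (c m)

/-- `P` is continuous. [cite: Zhang2022LandauSiegel, Prop 7.1 p.44 with (8.11)–(8.23)] -/
theorem continuous_modePoly (a : ℝ) : Continuous (modePoly s c a) :=
  continuous_iff_continuousAt.2 fun y => (hasDerivAt_modePoly s c a y).continuousAt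

/-- `P′` is continuous. [cite: Zhang2022LandauSiegel, Prop 7.1 p.44 with (8.11)–(8.23)] -/
theorem continuous_modePolyD (a : ℝ) : Continuous (modePolyD s c a) :=
  continuous_iff_continuousAt.2 fun y => (hasDerivAt_modePolyD s c a y).continuousAt

/-- `P″` is continuous. [cite: Zhang2022LandauSiegel, Prop 7.1 p.44 with (8.11)–(8.23)] -/
theorem continuous_modePolyDD (a : ℝ) : Continuous (modePolyDD s c a) := by
  unfold modePolyDD
  exact continuous_finsetSum _ fun m _ =>
    continuous_const.mul ((continuous_latticeModeDD m).comp (continuous_id.sub continuous_const))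

/-- `P(a) = Σ c_m` (all modes equal `1` at the base point). [cite: Zhang2022LandauSiegel, Prop 7.1 p.44 with (8.11)–(8.23)] -/
theorem modePoly_self (a : ℝ) : modePoly s c a a = ∑ m ∈ s, c m := by
  unfold modePoly
  simp [latticeMode_zero]

/-- Periodicity at the far end of the cell: `P_{s,c}(· − 1)` at `y = −1` equals `Σ c_m`.
[cite: Zhang2022LandauSiegel, Prop 7.1 p.44 with (8.11)–(8.23)] -/
theorem modePoly_one_neg_one : modePoly s c 1 (-1) = ∑ m ∈ s, c m := by
  unfold modePoly
  rw [show (-1:ℝ) - 1 = -2 by norm_num]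
  simp [latticeMode_neg_two]

/-- `P′(a) = iπ·Σ m·c_m` — the PIN functional. [cite: Zhang2022LandauSiegel, Prop 7.1 p.44 with (8.11)–(8.23)] -/
theorem modePolyD_self (a : ℝ) : modePolyD s c a a = (π : ℂ) * I * ∑ m ∈ s, (m : ℂ) * c m := by
  unfold modePolyD
  simp only [sub_self, latticeModeD_zero, Finset.mul_sum]
  refine Finset.sum_congr rfl fun m _ => ?_
  push_cast
  ring

/-- `P′(· − 1)` at `y = −1` is the same pin functional (periodicity of `P′`).
[cite: Zhang2022LandauSiegel, Prop 7.1 p.44 with (8.11)–(8.23)] -/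
theorem modePolyD_one_neg_one : modePolyD s c 1 (-1) = (π : ℂ) * I * ∑ m ∈ s, (m : ℂ) * c m := by
  unfold modePolyD
  rw [show (-1:ℝ) - 1 = -2 by norm_num]
  simp only [latticeModeD_neg_two, Finset.mul_sum]
  refine Finset.sum_congr rfl fun m _ => ?_
  push_cast
  ring

/-- **The pinned one-sided profile** `g_{s,c} = −P′_{s,c}(· − 1)` on `[0,1]` (so `tailPrim g = P − P(1)`).
[cite: Zhang2022LandauSiegel, Prop 7.1 p.44, (7.2)] -/
def pinProfile (s : Finset ℤ) (c : ℤ → ℂ) (y : ℝ) : ℂ := -modePolyD s c 1 y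

/-- Its derivative companion `−P″`. [cite: Zhang2022LandauSiegel, Prop 7.1 p.44, (7.2)] -/
def pinProfile' (s : Finset ℤ) (c : ℤ → ℂ) (y : ℝ) : ℂ := -modePolyDD s c 1 y

/-- The pinned profile is a kinked (indeed smooth) profile. [cite: Zhang2022LandauSiegel, Prop 7.1 p.44, (7.2)] -/
theorem kinkedProfile_pinProfile : KinkedProfile (pinProfile s c) (pinProfile' s c) := by
  have hc : Continuous (pinProfile s c) := (continuous_modePolyD s c 1).neg
  have hc' : Continuous (pinProfile' s c) := (continuous_modePolyDD s c 1).neg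
  refine ⟨hc.continuousOn, fun x _ => ?_, memLp_two_of_continuousOn_Icc' hc'.continuousOn⟩
  exact ((hasDerivAt_modePolyD s c 1 x).neg).hasDerivWithinAt

variable {s c}

/-- Under the pin `Σ m·c_m = 0` the profile is ONE-SIDED: `g(1) = 0`. [cite: Zhang2022LandauSiegel, Prop 7.1 p.44, (7.2)] -/
theorem pinProfile_one (hpin : ∑ m ∈ s, (m : ℂ) * c m = 0) : pinProfile s c 1 = 0 := by
  unfold pinProfile
  rw [modePolyD_self, hpin]
  simp

variable (s c)

/-- `tailPrim g = P − P(1)`. [cite: Zhang2022LandauSiegel, Prop 7.1 p.44 with (8.11)–(8.12)] -/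
theorem tailPrim_pinProfile (y : ℝ) : tailPrim (pinProfile s c) y = modePoly s c 1 y - modePoly s c 1 1 := by
  unfold tailPrim pinProfile
  rw [intervalIntegral.integral_neg, intervalIntegral.integral_eq_sub_of_hasDerivAt
    (fun t _ => hasDerivAt_modePoly s c 1 t) ((continuous_modePolyD s c 1).intervalIntegrable _ _)]
  ring

/-- `∫₀¹ g = P(0) − P(1)`. [cite: Zhang2022LandauSiegel, Prop 7.1 p.44 with (8.11)–(8.12)] -/
theorem integral_pinProfile : ∫ y in (0:ℝ)..1, pinProfile s c y = modePoly s c 1 0 - modePoly s c 1 1 := by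
  have h := tailPrim_pinProfile s c 0
  unfold tailPrim at h
  exact h

end TrigPoly

/-! ### Part 3 — the energy of `P − P(1)` over one period: `2π⁴·Σ_{m∈s} σ_b(m)‖c_m‖²` -/

section Cell

variable (b : Fin 3 → ℝ) (s : Finset ℤ) (c : ℤ → ℂ)

/-- The cell transform of `P − P(1)` on `[−1,1]`: `2c_m·F_m(−1)` on `m ∈ s`, minus `2P(1)` at `m = 0`.
[cite: Zhang2022LandauSiegel, Prop 7.1 p.44 with (8.11)–(8.23)] -/
theorem dpiece_cell_modePoly (m : ℤ) :
    dpiece (-1) 1 (fun y => modePoly s c 1 y - modePoly s c 1 1) m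
      = (if m ∈ s then 2 * c m * latticeMode m (-1) else 0)
        - (if m = 0 then 2 * modePoly s c 1 1 else 0) := by
  classical
  unfold dpiece
  have hI1 : IntervalIntegrable (fun y => modePoly s c 1 y * cexp (-(I * π * m * y))) volume (-1) 1 :=
    ((continuous_modePoly s c 1).mul ((continuous_latticeMode (-m)).congr
      fun y => (ker_eq_latticeMode m y).symm)).intervalIntegrable _ _
  have hI2 : IntervalIntegrable (fun y => modePoly s c 1 1 * cexp (-(I * π * m * y))) volume (-1) 1 :=
    (continuous_const.mul ((continuous_latticeMode (-m)).congr
      fun y => (ker_eq_latticeMode m y).symm)).intervalIntegrable _ _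
  simp_rw [sub_mul]
  rw [intervalIntegral.integral_sub hI1 hI2]
  congr 1
  · -- the polynomial part, mode by mode
    have hpt : ∀ y : ℝ, modePoly s c 1 y * cexp (-(I * π * m * y))
        = ∑ m' ∈ s, c m' * latticeMode m' (-1) * latticeMode (m' - m) y := by
      intro y
      unfold modePoly
      rw [Finset.sum_mul]
      refine Finset.sum_congr rfl fun m' _ => ?_
      rw [mul_assoc, latticeMode_sub_one_mul_ker, mul_assoc]
    simp_rw [hpt]
    rw [intervalIntegral.integral_finsetSum fun m' _ =>
      ((continuous_latticeMode (m' - m)).const_mul _).intervalIntegrable _ _]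
    simp_rw [intervalIntegral.integral_const_mul, integral_latticeMode_cell, sub_eq_zero]
    rw [show (∑ m' ∈ s, c m' * latticeMode m' (-1) * if m' = m then (2:ℂ) else 0)
        = ∑ m' ∈ s, (if m' = m then 2 * c m' * latticeMode m' (-1) else 0) from
      Finset.sum_congr rfl fun m' _ => by split_ifs <;> ring]
    rw [Finset.sum_ite_eq']
  · simp_rw [ker_eq_latticeMode]
    rw [intervalIntegral.integral_const_mul, integral_latticeMode_cell]
    simp only [neg_eq_zero]
    split_ifs <;> ring

/-- **The energy of `P − P(1)` over the period cell `[−1, 1]` is `2π⁴·Σ_{m∈s} σ_b(m)‖c_m‖²`** (Parseval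
`Det.hasSum_bulkFormOn_circle`; the constant sits on the zero-energy mode `σ_b(0) = 0`).
[cite: Zhang2022LandauSiegel, Prop 7.1 p.44 with (7.2), (8.11)–(8.23)] -/
theorem bulkFormOn_cell_modePoly :
    bulkFormOn b (-1) 1 (fun y => modePoly s c 1 y - modePoly s c 1 1) (modePolyD s c 1) (modePolyDD s c 1)
      = 2 * π ^ 4 * ∑ m ∈ s, latticeSymbol b m * ‖c m‖ ^ 2 := by
  classical
  set F : ℝ → ℂ := fun y => modePoly s c 1 y - modePoly s c 1 1 with hF
  have e12 : (-1:ℝ) + 2 = 1 := by norm_num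
  have cF : Continuous F := (continuous_modePoly s c 1).sub continuous_const
  have hS : ContinuousOn F (Icc (-1) (-1 + 2)) := cF.continuousOn
  have hS' : ContinuousOn (modePolyD s c 1) (Icc (-1) (-1 + 2)) := (continuous_modePolyD s c 1).continuousOn
  have h1 : ∀ y ∈ Ioo (-1:ℝ) (-1 + 2), y ∉ (∅ : Finset ℝ) →
      HasDerivWithinAt F (modePolyD s c 1 y) (Ioi y) y :=
    fun y _ _ => ((hasDerivAt_modePoly s c 1 y).sub_const _).hasDerivWithinAt
  have h2 : ∀ y ∈ Ioo (-1:ℝ) (-1 + 2), y ∉ (∅ : Finset ℝ) →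
      HasDerivWithinAt (modePolyD s c 1) (modePolyDD s c 1 y) (Ioi y) y :=
    fun y _ _ => (hasDerivAt_modePolyD s c 1 y).hasDerivWithinAt
  have hS''m : MemLp (modePolyDD s c 1) 2 (volume.restrict (Ioc (-1:ℝ) (-1 + 2))) :=
    memLp_two_of_continuousOn_Icc' (continuous_modePolyDD s c 1).continuousOn
  have hp0 : F (-1) = F (-1 + 2) := by
    rw [e12, hF]
    simp only [modePoly_one_neg_one, modePoly_self, sub_self]
  have hp1 : modePolyD s c 1 (-1) = modePolyD s c 1 (-1 + 2) := by
    rw [e12, modePolyD_one_neg_one, modePolyD_self]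
  have H := hasSum_bulkFormOn_circle b (-1) ∅ hS hS' h1 h2 hS''m hp0 hp1
  -- the terms of the Parseval series: supported on `s`, equal to `2π⁴σ_b(m)‖c_m‖²` there
  have hterm : ∀ m : ℤ, π ^ 4 / 2 *
      (((m : ℝ) ^ 4 + (b 0 + b 1 + b 2) * (m : ℝ) ^ 3 + (b 0 * b 1 + b 1 * b 2 + b 2 * b 0) * (m : ℝ) ^ 2
          + (b 0 * b 1 * b 2) * (m : ℝ)) * ‖dpiece (-1) (-1 + 2) F m‖ ^ 2)
        = if m ∈ s then 2 * π ^ 4 * (latticeSymbol b m * ‖c m‖ ^ 2) else 0 := by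
    intro m
    rw [← latticeSymbol_eq, e12]
    by_cases hm0 : m = 0
    · subst hm0
      have : latticeSymbol b 0 = 0 := by simp [latticeSymbol]
      simp [this]
    · rw [hF, dpiece_cell_modePoly, if_neg hm0, sub_zero]
      split_ifs with hms
      · rw [norm_mul, norm_mul, norm_latticeMode, Complex.norm_two]
        ring
      · simp
  have H2 : HasSum (fun m : ℤ => π ^ 4 / 2 *
      (((m : ℝ) ^ 4 + (b 0 + b 1 + b 2) * (m : ℝ) ^ 3 + (b 0 * b 1 + b 1 * b 2 + b 2 * b 0) * (m : ℝ) ^ 2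
          + (b 0 * b 1 * b 2) * (m : ℝ)) * ‖dpiece (-1) (-1 + 2) F m‖ ^ 2))
      (∑ m ∈ s, 2 * π ^ 4 * (latticeSymbol b m * ‖c m‖ ^ 2)) := by
    have h0 : HasSum (fun m : ℤ => π ^ 4 / 2 *
        (((m : ℝ) ^ 4 + (b 0 + b 1 + b 2) * (m : ℝ) ^ 3 + (b 0 * b 1 + b 1 * b 2 + b 2 * b 0) * (m : ℝ) ^ 2
          + (b 0 * b 1 * b 2) * (m : ℝ)) * ‖dpiece (-1) (-1 + 2) F m‖ ^ 2))
        (∑ m ∈ s, π ^ 4 / 2 *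
          (((m : ℝ) ^ 4 + (b 0 + b 1 + b 2) * (m : ℝ) ^ 3 + (b 0 * b 1 + b 1 * b 2 + b 2 * b 0) * (m : ℝ) ^ 2
            + (b 0 * b 1 * b 2) * (m : ℝ)) * ‖dpiece (-1) (-1 + 2) F m‖ ^ 2)) :=
      hasSum_sum_of_ne_finset_zero fun m hm => by rw [hterm m, if_neg hm]
    have hsum : (∑ m ∈ s, π ^ 4 / 2 *
        (((m : ℝ) ^ 4 + (b 0 + b 1 + b 2) * (m : ℝ) ^ 3 + (b 0 * b 1 + b 1 * b 2 + b 2 * b 0) * (m : ℝ) ^ 2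
          + (b 0 * b 1 * b 2) * (m : ℝ)) * ‖dpiece (-1) (-1 + 2) F m‖ ^ 2))
        = ∑ m ∈ s, 2 * π ^ 4 * (latticeSymbol b m * ‖c m‖ ^ 2) :=
      Finset.sum_congr rfl fun m hm => by rw [hterm m, if_pos hm]
    rw [hsum] at h0
    exact h0
  have key := H.unique H2
  rw [e12] at key
  rw [key, Finset.mul_sum]

end Cell

/-! ### Part 4 — the witness inequality (case (A)) and the FAIL theorem -/

section Main

variable {b : Fin 3 → ℝ} (s : Finset ℤ) (c : ℤ → ℂ)

/-- **[K1] for the pinned profile:** `(π/2)·𝔅_{R(b)}(g) = c₀·T_b^{[0,1]}(P − P(1)) + freeEndForm b (P(0) − P(1)) (P′(0))`.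
[cite: Zhang2022LandauSiegel, Prop 7.1 p.44 with (8.11)–(8.23)] -/
theorem formDet_pinProfile_eq (hb : Function.Injective b) (hpin : ∑ m ∈ s, (m : ℂ) * c m = 0) :
    π / 2 * FormDet (shiftRecipe b) (pinProfile s c) (pinProfile' s c)
      = (∑ j : Fin 3, shiftW b j).re *
          bulkFormOn b 0 1 (fun y => modePoly s c 1 y - modePoly s c 1 1) (modePolyD s c 1) (modePolyDD s c 1)
        + freeEndForm b (modePoly s c 1 0 - modePoly s c 1 1) (modePolyD s c 1 0) := by
  rw [formDet_shiftRecipe_eq_bulk_add_freeEnd hb (kinkedProfile_pinProfile s c) (pinProfile_one hpin)]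
  have h1 : tailPrim (pinProfile s c) = fun y => modePoly s c 1 y - modePoly s c 1 1 :=
    funext (tailPrim_pinProfile s c)
  have h2 : (fun y => -pinProfile s c y) = modePolyD s c 1 := by
    funext y; simp [pinProfile]
  have h3 : (fun y => -pinProfile' s c y) = modePolyDD s c 1 := by
    funext y; simp [pinProfile']
  have h4 : -pinProfile s c 0 = modePolyD s c 1 0 := by simp [pinProfile]
  rw [h1, h2, h3, h4, integral_pinProfile]

/-- **CASE (A) WITNESS INEQUALITY.** For pairwise-distinct `b` with `c₀(b) > 0` and the doubly-clamped bulk form PSD, every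
pinned mode vector (`Σ_{m∈s} m·c_m = 0`) has `(π/2)·𝔅_{R(b)}(g_{s,c}) ≤ c₀(b)·2π⁴·Σ_{m∈s} σ_b(m)‖c_m‖²`: the free-end bridge
(= `c₀·T(E)`, D1) costs no more than the competitor `P(·−1) − P(1)` with the same four jets (the pin makes its far jet
vanish), and the two arcs of `P − P(1)` make one period, diagonal on the lattice.
[cite: Zhang2022LandauSiegel, §2 (2.32)–(2.33); Prop 7.1 p.44 with (7.2), (8.11)–(8.23)] -/
theorem formDet_pinProfile_le (hb : Function.Injective b) (hc : 0 < (∑ j : Fin 3, shiftW b j).re)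
    (hQ : ClampedBulkNonneg b) (hpin : ∑ m ∈ s, (m : ℂ) * c m = 0) :
    π / 2 * FormDet (shiftRecipe b) (pinProfile s c) (pinProfile' s c)
      ≤ (∑ j : Fin 3, shiftW b j).re * (2 * π ^ 4 * ∑ m ∈ s, latticeSymbol b m * ‖c m‖ ^ 2) := by
  have h01 : b 0 ≠ b 1 := fun h => by have := hb h; exact absurd this (by decide)
  have h02 : b 0 ≠ b 2 := fun h => by have := hb h; exact absurd this (by decide)
  have h12 : b 1 ≠ b 2 := fun h => by have := hb h; exact absurd this (by decide)
  have hc' : (atomA0 b).re ≠ 0 := hc.ne'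
  rw [formDet_pinProfile_eq s c hb hpin]
  set P : ℝ → ℂ := modePoly s c 1 with hP
  set P' : ℝ → ℂ := modePolyD s c 1 with hP'
  set P'' : ℝ → ℂ := modePolyDD s c 1 with hP''
  set F : ℝ → ℂ := fun y => P y - P 1 with hF
  set x₁ : ℂ := P 0 - P 1 with hx₁
  set x₂ : ℂ := P' 0 with hx₂
  -- D1: the free-end form is `c₀` times the clamped extremal's energy
  have hD1 := doublingIdentity_clamped_of_re_ne_zero b x₁ x₂ h01 h02 h12 hc'
  obtain ⟨hE0, hE0', hE1, hE1'⟩ := clampedExt_boundary_of_re_ne_zero b x₁ x₂ h01 h02 h12 hc'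
  set γ := clampedCoeff b x₁ x₂ with hγ
  -- the competitor `ψ = P(·−1) − P(1)` and the clamped difference `φ = ψ − E`
  set ψ : ℝ → ℂ := fun y => P (y - 1) - P 1 with hψ
  set ψ' : ℝ → ℂ := fun y => P' (y - 1) with hψ'
  set ψ'' : ℝ → ℂ := fun y => P'' (y - 1) with hψ''
  have dψ : ∀ t, HasDerivAt ψ (ψ' t) t := fun t => by
    have := ((hasDerivAt_modePoly s c 1 (t - 1)).comp_sub_const t 1).sub_const (P 1)
    simpa [hψ, hψ', hP, hP'] using this
  have dψ' : ∀ t, HasDerivAt ψ' (ψ'' t) t := fun t => by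
    have := (hasDerivAt_modePolyD s c 1 (t - 1)).comp_sub_const t 1
    simpa [hψ', hψ'', hP', hP''] using this
  set φ : ℝ → ℂ := fun y => ψ y - extremal b γ y with hφ
  set φ' : ℝ → ℂ := fun y => ψ' y - extremalD b γ y with hφ'
  set φ'' : ℝ → ℂ := fun y => ψ'' y - extremalDD b γ y with hφ''
  have dφ : ∀ t ∈ uIcc (0:ℝ) 1, HasDerivAt φ (φ' t) t := fun t _ => (dψ t).sub (hasDerivAt_extremal b γ t)
  have dφ' : ∀ t ∈ uIcc (0:ℝ) 1, HasDerivAt φ' (φ'' t) t := fun t _ => (dψ' t).sub (hasDerivAt_extremalD b γ t)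
  have cψ'' : Continuous ψ'' := (continuous_modePolyDD s c 1).comp (continuous_id.sub continuous_const)
  have cφ'' : ContinuousOn φ'' (Icc 0 1) := (cψ''.sub (continuous_extremalDD b γ)).continuousOn
  -- the four clamps
  have f0 : φ 0 = 0 := by
    simp only [hφ, hψ, hP, hE0, sub_zero, zero_sub]
    rw [show (-1:ℝ) = -1 from rfl, modePoly_one_neg_one, modePoly_self, sub_self]
  have f0' : φ' 0 = 0 := by
    simp only [hφ', hψ', hP', hE0', sub_zero, zero_sub]
    rw [modePolyD_one_neg_one, hpin, mul_zero]
  have f1 : φ 1 = 0 := by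
    simp only [hφ, hψ, hE1, hx₁]
    norm_num
  have f1' : φ' 1 = 0 := by
    simp only [hφ', hψ', hE1', hx₂]
    norm_num
  -- minimality of the bridge
  have hmin := bulkFormOn_extremal_le_of_clampedNonneg b γ dφ dφ' cφ'' f0 f1 f0' f1'
    (hQ φ φ' φ'' dφ dφ' cφ'' f0 f1 f0' f1')
  have hsum : bulkFormOn b 0 1 (fun y => extremal b γ y + φ y) (fun y => extremalD b γ y + φ' y)
      (fun y => extremalDD b γ y + φ'' y) = bulkFormOn b 0 1 ψ ψ' ψ'' := by
    congr 1 <;> funext y <;> simp [hφ, hφ', hφ'']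
  rw [hsum] at hmin
  -- the competitor's energy is the left arc of `F`
  have hshift : bulkFormOn b 0 1 ψ ψ' ψ'' = bulkFormOn b (-1) 0 F P' P'' := by
    rw [← bulkFormOn_comp_add_one b ψ ψ' ψ'']
    congr 1 <;> funext y <;> simp [hψ, hψ', hψ'', hF]
  -- additivity over the cell and the lattice energy
  have cF : Continuous F := (continuous_modePoly s c 1).sub continuous_const
  have hadd := bulkFormOn_add_adjacent b (a := -1) (x := 0) (d := 1) (S := F) (S' := P') (S'' := P'')
    ⟨by norm_num, by norm_num⟩ cF.continuousOn (continuous_modePolyD s c 1).continuousOn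
    (memLp_two_of_continuousOn_Icc' (continuous_modePolyDD s c 1).continuousOn)
  have hcell : bulkFormOn b (-1) 1 F P' P'' = 2 * π ^ 4 * ∑ m ∈ s, latticeSymbol b m * ‖c m‖ ^ 2 :=
    bulkFormOn_cell_modePoly b s c
  -- assemble
  have hc0 : 0 ≤ (atomA0 b).re := hc.le
  have e1 : (∑ j : Fin 3, shiftW b j).re = (atomA0 b).re := rfl
  rw [e1, ← hD1]
  calc (atomA0 b).re * bulkFormOn b 0 1 F P' P''
        + (atomA0 b).re * bulkFormOn b 0 1 (extremal b γ) (extremalD b γ) (extremalDD b γ)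
      ≤ (atomA0 b).re * bulkFormOn b 0 1 F P' P'' + (atomA0 b).re * bulkFormOn b 0 1 ψ ψ' ψ'' := by
        gcongr
    _ = (atomA0 b).re * bulkFormOn b (-1) 1 F P' P'' := by rw [hshift, hadd]; ring
    _ = (atomA0 b).re * (2 * π ^ 4 * ∑ m ∈ s, latticeSymbol b m * ‖c m‖ ^ 2) := by rw [hcell]

/-- **CASE (A), NEGATIVE ENERGY ⇒ NEGATIVE FORM:** with the pin and `Σ_{m∈s} σ_b(m)‖c_m‖² < 0`, `𝔅_{R(b)}(g_{s,c}) < 0`.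
[cite: Zhang2022LandauSiegel, §2 Lemma 2.3; Prop 7.1 p.44 with (7.2), (8.11)–(8.23)] -/
theorem formDet_pinProfile_neg (hb : Function.Injective b) (hc : 0 < (∑ j : Fin 3, shiftW b j).re)
    (hQ : ClampedBulkNonneg b) (hpin : ∑ m ∈ s, (m : ℂ) * c m = 0)
    (hneg : ∑ m ∈ s, latticeSymbol b m * ‖c m‖ ^ 2 < 0) :
    FormDet (shiftRecipe b) (pinProfile s c) (pinProfile' s c) < 0 := by
  have h := formDet_pinProfile_le s c hb hc hQ hpin
  have hπ4 : 0 < 2 * π ^ 4 := by positivity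
  have hrhs : (∑ j : Fin 3, shiftW b j).re * (2 * π ^ 4 * ∑ m ∈ s, latticeSymbol b m * ‖c m‖ ^ 2) < 0 :=
    mul_neg_of_pos_of_neg hc (mul_neg_of_pos_of_neg hπ4 hneg)
  have hπ : 0 < π / 2 := by positivity
  by_contra hnn
  have : 0 ≤ FormDet (shiftRecipe b) (pinProfile s c) (pinProfile' s c) := le_of_not_gt hnn
  nlinarith [mul_nonneg hπ.le this]

/-- **PINNED NEGATIVE LATTICE ENERGY ⇒ THE ONE-SIDED SLOT FAILS.** For pairwise-distinct `b` with `c₀(b) > 0`: a finite set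
of modes `s`, coefficients `c` with ONE pin `Σ_{m∈s} m·c_m = 0` and `Σ_{m∈s} σ_b(m)‖c_m‖² < 0` give
`¬ Det.FormDetPSD (Det.shiftRecipe b)` — case (A) by the pinned profile, case (B) by the clamped witness
(`Det.not_formDetPSD_of_clampedNegWitness`), so `ClampedBulkNonneg` drops out. One linear constraint kills at most one
negative direction of the lattice-diagonal form. [cite: Zhang2022LandauSiegel, §2 Lemma 2.3; Prop 7.1 p.44 with (7.2), (8.11)–(8.23); §18 (18.1)] -/
theorem not_formDetPSD_of_pinnedModes (hb : Function.Injective b) (hc : 0 < (∑ j : Fin 3, shiftW b j).re)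
    (s : Finset ℤ) (c : ℤ → ℂ) (hpin : ∑ m ∈ s, (m : ℂ) * c m = 0)
    (hneg : ∑ m ∈ s, latticeSymbol b m * ‖c m‖ ^ 2 < 0) : ¬ FormDetPSD (shiftRecipe b) := by
  by_cases hQ : ClampedBulkNonneg b
  · intro h
    have h1 := h _ _ (kinkedProfile_pinProfile s c) (pinProfile_one hpin)
    have h2 := formDet_pinProfile_neg s c hb hc hQ hpin hneg
    linarith
  · intro h
    apply hQ
    intro φ φ' φ'' dφ dφ' cφ'' f0 f1 f0' f1'
    by_contra hneg'
    have hlt : bulkFormOn b 0 1 φ φ' φ'' < 0 := lt_of_not_ge hneg'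
    have cφ : ContinuousOn φ (Icc 0 1) := fun t ht =>
      (dφ t (by rwa [uIcc_of_le zero_le_one])).continuousAt.continuousWithinAt
    have cφ' : ContinuousOn φ' (Icc 0 1) := fun t ht =>
      (dφ' t (by rwa [uIcc_of_le zero_le_one])).continuousAt.continuousWithinAt
    exact not_formDetPSD_of_clampedNegWitness hb hc cφ cφ'
      (fun y hy => (dφ y (by rw [uIcc_of_le zero_le_one]; exact Ioo_subset_Icc_self hy)).hasDerivWithinAt)
      (fun y hy => (dφ' y (by rw [uIcc_of_le zero_le_one]; exact Ioo_subset_Icc_self hy)).hasDerivWithinAt)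
      (memLp_two_of_continuousOn_Icc' cφ'') f0 f1 f0' f1' hlt h

/-- … hence Family B's no-overlap glued slot fails too. [cite: Zhang2022LandauSiegel, Prop 7.1 p.44 with (7.2); §18 (18.1)] -/
theorem not_gluedFormPSD_of_pinnedModes (hb : Function.Injective b) (hc : 0 < (∑ j : Fin 3, shiftW b j).re)
    (s : Finset ℤ) (c : ℤ → ℂ) (hpin : ∑ m ∈ s, (m : ℂ) * c m = 0)
    (hneg : ∑ m ∈ s, latticeSymbol b m * ‖c m‖ ^ 2 < 0) : ¬ GluedFormPSD b :=
  not_gluedFormPSD_of_not_formDetPSD (not_formDetPSD_of_pinnedModes hb hc s c hpin hneg)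

/-- … and Family A's windowed `H¹` slot (`b_j ≠ 0`). [cite: Zhang2022LandauSiegel, §4 (4.1); §18 (18.1)] -/
theorem not_dictShiftPSD_of_pinnedModes (hb : Function.Injective b) (hb0 : ∀ j, b j ≠ 0)
    (hc : 0 < (∑ j : Fin 3, shiftW b j).re) (s : Finset ℤ) (c : ℤ → ℂ) (hpin : ∑ m ∈ s, (m : ℂ) * c m = 0)
    (hneg : ∑ m ∈ s, latticeSymbol b m * ‖c m‖ ^ 2 < 0) : ¬ DictShiftPSD b :=
  not_dictShiftPSD_of_not_gluedFormPSD hb0 (not_gluedFormPSD_of_pinnedModes hb hc s c hpin hneg)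

end Main

/-! ### Part 5 — the two FAIL clauses of the slot-region criterion -/

section Clauses

variable {b : Fin 3 → ℝ}

/-- **TWO BAD MODES ⇒ FAIL («N(b) ≥ 2», or one negative mode and one zero mode):** lattice points `m₁ ≠ m₂`, `m₂ ≠ 0`, with
`σ_b(m₁) < 0` and `σ_b(m₂) ≤ 0` ⇒ `¬ FormDetPSD (shiftRecipe b)` (pairwise-distinct `b`, `c₀(b) > 0`); the pinned vector is
`c = (m₂, −m₁)` on `{m₁, m₂}`. [cite: Zhang2022LandauSiegel, §2 Lemma 2.3; Prop 7.1 p.44 with (7.2), (8.11)–(8.23)] -/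
theorem not_formDetPSD_of_two_modes (hb : Function.Injective b) (hc : 0 < (∑ j : Fin 3, shiftW b j).re)
    {m₁ m₂ : ℤ} (hne : m₁ ≠ m₂) (hm₂ : m₂ ≠ 0) (h₁ : latticeSymbol b m₁ < 0) (h₂ : latticeSymbol b m₂ ≤ 0) :
    ¬ FormDetPSD (shiftRecipe b) := by
  classical
  refine not_formDetPSD_of_pinnedModes hb hc {m₁, m₂} (fun m => if m = m₁ then (m₂ : ℂ) else -(m₁ : ℂ)) ?_ ?_
  · rw [Finset.sum_pair hne, if_pos rfl, if_neg hne.symm]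
    ring
  · rw [Finset.sum_pair hne, if_pos rfl, if_neg hne.symm, norm_neg, Complex.norm_intCast, Complex.norm_intCast,
      sq_abs, sq_abs]
    have hm₂' : (0:ℝ) < (m₂ : ℝ) ^ 2 := by
      have : (m₂ : ℝ) ≠ 0 := Int.cast_ne_zero.2 hm₂
      positivity
    nlinarith [sq_nonneg (m₁ : ℝ)]

/-- **PIN-INDEX EXCESS ⇒ FAIL (the finitary form of «N = 1 ∧ S(b) > 0»):** one mode `m₀` with `σ_b(m₀) < 0` and a finite set
`t` of modes with `σ_b > 0` such that `m₀² < |σ_b(m₀)|·Σ_{m∈t} m²/σ_b(m)` ⇒ `¬ FormDetPSD (shiftRecipe b)` (pairwise-distinct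
`b`, `c₀(b) > 0`). The pinned vector: `c_m = m/σ_b(m)` on `t`, `c_{m₀} = −R/m₀`, `R = Σ_{t} m²/σ_b(m)`; its energy is
`R·(m₀² + σ_b(m₀)R)/m₀² < 0`. Any positive pin index is witnessed by a finite `t`.
[cite: Zhang2022LandauSiegel, §2 Lemma 2.3; Prop 7.1 p.44 with (7.2), (8.11)–(8.23)] -/
theorem not_formDetPSD_of_pin_excess (hb : Function.Injective b) (hc : 0 < (∑ j : Fin 3, shiftW b j).re)
    {m₀ : ℤ} (h₀ : latticeSymbol b m₀ < 0) (t : Finset ℤ) (ht : ∀ m ∈ t, 0 < latticeSymbol b m)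
    (hex : (m₀ : ℝ) ^ 2 < |latticeSymbol b m₀| * ∑ m ∈ t, (m : ℝ) ^ 2 / latticeSymbol b m) :
    ¬ FormDetPSD (shiftRecipe b) := by
  classical
  set R : ℝ := ∑ m ∈ t, (m : ℝ) ^ 2 / latticeSymbol b m with hR
  have hm₀t : m₀ ∉ t := fun h => by linarith [ht m₀ h]
  have hm₀ : m₀ ≠ 0 := by
    rintro rfl
    simp [latticeSymbol] at h₀
  have hm₀' : (m₀ : ℝ) ≠ 0 := Int.cast_ne_zero.2 hm₀
  have hσ₀ : |latticeSymbol b m₀| = -latticeSymbol b m₀ := abs_of_neg h₀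
  have hRpos : 0 < R := by
    by_contra hle
    push Not at hle
    nlinarith [abs_nonneg (latticeSymbol b m₀), sq_nonneg (m₀ : ℝ), mul_nonneg (abs_nonneg (latticeSymbol b m₀))
      (neg_nonneg.2 hle)]
  refine not_formDetPSD_of_pinnedModes hb hc (insert m₀ t)
    (fun m => if m = m₀ then (((-(R / m₀) : ℝ)) : ℂ) else ((((m : ℝ) / latticeSymbol b m : ℝ)) : ℂ)) ?_ ?_
  · have hsum : ∑ m ∈ t, (m : ℂ) *
        (if m = m₀ then (((-(R / m₀) : ℝ)) : ℂ) else ((((m : ℝ) / latticeSymbol b m : ℝ)) : ℂ)) = ((R : ℝ) : ℂ) := by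
      rw [hR]
      push_cast
      refine Finset.sum_congr rfl fun m hm => ?_
      rw [if_neg (ne_of_mem_of_not_mem hm hm₀t)]
      ring
    rw [Finset.sum_insert hm₀t, if_pos rfl, hsum]
    push_cast
    field_simp
    ring
  · have hsum : ∑ m ∈ t, latticeSymbol b m *
        ‖(if m = m₀ then (((-(R / m₀) : ℝ)) : ℂ) else ((((m : ℝ) / latticeSymbol b m : ℝ)) : ℂ))‖ ^ 2 = R := by
      rw [hR]
      refine Finset.sum_congr rfl fun m hm => ?_
      rw [if_neg (ne_of_mem_of_not_mem hm hm₀t), Complex.norm_real, Real.norm_eq_abs, sq_abs]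
      have hσ : latticeSymbol b m ≠ 0 := (ht m hm).ne'
      field_simp
    rw [Finset.sum_insert hm₀t, if_pos rfl, hsum, Complex.norm_real, Real.norm_eq_abs, sq_abs]
    -- `σ₀·(R/m₀)² + R < 0  ⟸  m₀² < −σ₀·R`
    rw [hσ₀] at hex
    have hm₀sq : (0:ℝ) < (m₀ : ℝ) ^ 2 := by positivity
    have key : latticeSymbol b m₀ * (-(R / (m₀ : ℝ))) ^ 2 + R
        = R * ((m₀ : ℝ) ^ 2 + latticeSymbol b m₀ * R) / (m₀ : ℝ) ^ 2 := by
      field_simp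
      ring
    rw [key]
    apply div_neg_of_neg_of_pos _ hm₀sq
    nlinarith

/-- The glued-slot version of the two-modes clause. [cite: Zhang2022LandauSiegel, Prop 7.1 p.44 with (7.2); §18 (18.1)] -/
theorem not_gluedFormPSD_of_two_modes (hb : Function.Injective b) (hc : 0 < (∑ j : Fin 3, shiftW b j).re)
    {m₁ m₂ : ℤ} (hne : m₁ ≠ m₂) (hm₂ : m₂ ≠ 0) (h₁ : latticeSymbol b m₁ < 0) (h₂ : latticeSymbol b m₂ ≤ 0) :
    ¬ GluedFormPSD b :=
  not_gluedFormPSD_of_not_formDetPSD (not_formDetPSD_of_two_modes hb hc hne hm₂ h₁ h₂)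

/-- The glued-slot version of the pin-excess clause. [cite: Zhang2022LandauSiegel, Prop 7.1 p.44 with (7.2); §18 (18.1)] -/
theorem not_gluedFormPSD_of_pin_excess (hb : Function.Injective b) (hc : 0 < (∑ j : Fin 3, shiftW b j).re)
    {m₀ : ℤ} (h₀ : latticeSymbol b m₀ < 0) (t : Finset ℤ) (ht : ∀ m ∈ t, 0 < latticeSymbol b m)
    (hex : (m₀ : ℝ) ^ 2 < |latticeSymbol b m₀| * ∑ m ∈ t, (m : ℝ) ^ 2 / latticeSymbol b m) :
    ¬ GluedFormPSD b :=
  not_gluedFormPSD_of_not_formDetPSD (not_formDetPSD_of_pin_excess hb hc h₀ t ht hex)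

end Clauses

end Det

end Literature.NumberTheory.LFunctions.Zhang2022
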